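import Summits.HodgeConjecture.HodgeConjecture.Theorems.TropicalWeilObstructionTropicalWeilVanishingClassPositivityCertData

/-!
# Crux `TropicalWeilVanishing` (K1 of route `TropicalWeilObstruction`, stmt-HodgeConjecture-18478):
# the class-positivity certificate `κ = 8` — part 2, the computable CHECKER

Route `HodgeConjecture/TropicalWeilObstruction` is a REFUTATION route (Kontsevich's tropical test, negative
branch); this file is negation-sink bookkeeping of the cell `pub-hodge-tropical` (seat tropical-1) and
decides nothing about the Hodge conjecture, in either direction, and nothing about the OPEN crux K1
(`TropicalWeilVanishing`, stmt-HodgeConjecture-18478).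

Definitions only (pattern of K3's `…TropicalHodgeBoundChkCore`): decoding of the data of
`…ClassPositivityCertData` and the three checks run by the kernel in `…ClassPositivityCertRun`, written
as structural recursions over the data lists so that kernel reduction only does integer arithmetic on
literals:
* digit conventions `sgd` (`0, 1, 2 ↦ 0, 1, -1`), frame entries `ent f a b` (base-`4` digit `4a + b` of the
  frame code `f`), the frame `frameOf f : Matrix (Fin 8) (Fin 4) ℤ`, the left inverse `invOf m` (digit
  `8a + r` of the code `m`), the multiplicities `wt` (constant on the six orbits), the digit list `wl w` and
  the Plücker coordinate `plkD f w` of `frameOf f` at the word with octal code `w` (K3's `Chk.det4R`,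
  `Chk.wd`), the target `targetD w w' = 24 · (8 · θ₄(1) + Re w(1))(w, w')` from K3's `Chk.basisN`, the
  column digits `cdig`, the product entry `satEntry`;
* `checkSat` (`M_t L_t = 1`: every frame is saturated, hence a legal `TropicalCell.frame`),
  `checkCols lo n` (the packed columns ARE the Plücker coordinates: `206 × 70` explicit `4 × 4`
  determinants, columns `lo ≤ r < lo + n`), `checkSparse` (the sparse table agrees with the packed
  columns), `checkGram lo n` (the Gram identity `Σ_t n_t p_t(I) p_t(J) = 24 (8 θ₄(1) + Re w(1))(I, J)` on
  the increasing word pairs `I ≤ J`, sparse row against packed column).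
Soundness of the checks and the bridges to K3's classes are in `…ClassPositivitySound`; the theorem in
`…ClassPositivityCone`.

## References
* [Zharkov2020TropicalWeil] I. Zharkov, Tropical abelian varieties, Weil classes and the Hodge conjecture,
  arXiv:2002.02347, §2 (pp. 2–4).
* [MikhalkinZharkov2014Eigenwave] G. Mikhalkin, I. Zharkov, Tropical eigenwave and intermediate Jacobians,
  Prop. 4.3.
* [BlekhermanSmithVelasco2016] G. Blekherman, G. G. Smith, M. Velasco, Sums of squares and varieties of
  minimal degree, J. Amer. Math. Soc. 29 (2016), Thm. 1.1.
-/

set_option linter.dupNamespace false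

namespace Summit.HodgeConjecture.HodgeConjecture.Theorems.TropicalWeilVanishing

namespace Kappa

open Summit.HodgeConjecture.HodgeConjecture.Theorems.TropicalHodgeBound

/-! ### Digit conventions, frames, left inverses, multiplicities -/

/-- Signed digit: `0 ↦ 0`, `1 ↦ 1`, anything else (`2`, `3`) `↦ -1`. [folklore] -/
def sgd (d : ℕ) : ℤ := if d = 0 then 0 else if d = 1 then 1 else -1

/-- Entry `(a, b)` (`a < 8`, `b < 4`) of the frame with code `f`: base-`4` digit `4a + b`. [folklore] -/
def ent (f a b : ℕ) : ℤ := sgd (f / 4 ^ (4 * a + b) % 4)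

/-- The integer `8 × 4` frame (columns `l₁ | … | l₄ ∈ ℤ⁸`) with code `f`. [folklore] -/
def frameOf (f : ℕ) : Matrix (Fin (2 * 4)) (Fin 4) ℤ := fun a b => ent f a b

/-- Entry `(a, r)` (`a < 4`, `r < 8`) of the left inverse with code `m`: base-`4` digit `8a + r`. [folklore] -/
def inve (m a r : ℕ) : ℤ := sgd (m / 4 ^ (8 * a + r) % 4)

/-- The integer `4 × 8` matrix with code `m` (a left inverse of the frame of the same index). [folklore] -/
def invOf (m : ℕ) : Matrix (Fin 4) (Fin (2 * 4)) ℤ := fun a r => inve m a r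

/-- The multiplicity `n_t` of frame `t` (constant on the six orbits, sizes `6, 8, 48, 48, 48, 48`:
`192, 96, 176, 4, 8, 1` = `24 ×` the rational coefficients `8, 4, 22/3, 1/6, 1/3, 1/24`). [folklore] -/
def wt (t : ℕ) : ℕ :=
  if t < 6 then 192 else if t < 14 then 96 else if t < 62 then 176 else if t < 110 then 4
  else if t < 158 then 8 else 1

/-- The digit list `[a, b, c, d]` of a word code `512a + 64b + 8c + d` (K3's `Chk.wd`). [folklore] -/
def wl (w : ℕ) : List ℕ := [Chk.wd w 0, Chk.wd w 1, Chk.wd w 2, Chk.wd w 3]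

/-- The Plücker coordinate of `frameOf f` at the word with code `w` (explicit `4 × 4` determinant of the
selected rows, K3's `Chk.det4R`). [folklore] -/
def plkD (f w : ℕ) : ℤ := Chk.det4R fun (a : Fin 4) (b : Fin 4) => ent f (Chk.wd w a) b

/-- The target `24 · (8 · θ₄(1) + Re w(1))` at the pair of words with codes `(w, w')`, from K3's
`Chk.basisN` (`θ₄(1)(I,J) = [I = J]`, `w(1)(I,J) = det Ω[I,·] · det Ω[J,·]` on increasing words).
[folklore] -/
def targetD (w w' : ℕ) : ℤ :=
  24 * (8 * (Chk.basisN (wl w) (wl w')).1 + (Chk.basisN (wl w) (wl w')).2.1)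

/-- Signed base-`4` digit `t` of a column code `c`. [folklore] -/
def cdig (c t : ℕ) : ℤ := sgd (c / 4 ^ t % 4)

/-- Entry `(a, b)` of `invOf m * frameOf f` as an explicit eight-term sum. [folklore] -/
def satEntry (m f : ℕ) (a b : ℕ) : ℤ :=
  inve m a 0 * ent f 0 b + inve m a 1 * ent f 1 b + inve m a 2 * ent f 2 b + inve m a 3 * ent f 3 b +
    inve m a 4 * ent f 4 b + inve m a 5 * ent f 5 b + inve m a 6 * ent f 6 b + inve m a 7 * ent f 7 b

/-! ### The checks (run by the kernel in `…ClassPositivityCertRun`) -/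

/-- Saturation, over the two code lists in lockstep: every `M_t L_t` is the identity. [folklore] -/
def checkSatL : List ℕ → List ℕ → Bool
  | m :: ms, f :: fs =>
      decide (∀ a b : Fin 4, satEntry m f a b = if a = b then 1 else 0) && checkSatL ms fs
  | _, _ => true

/-- Saturation check on the data. [folklore] -/
def checkSat : Bool := checkSatL invCode frameCode

/-- Column check at the word with code `w`: digits `k, k+1, …` of `c` are the Plücker coordinates of the
listed frames at that word. [folklore] -/
def colL (w c : ℕ) : List ℕ → ℕ → Bool
  | [], _ => true
  | f :: fs, k => decide (cdig c k = plkD f w) && colL w c fs (k + 1)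

/-- Column check over `n` entries of the word and column lists in lockstep. [folklore] -/
def checkColsL : ℕ → List ℕ → List ℕ → Bool
  | n + 1, w :: ws, c :: cs => colL w c frameCode 0 && checkColsL n ws cs
  | _, _, _ => true

/-- The column codes of ranks `lo ≤ r < lo + n` are the Plücker columns of the `206` frames. [folklore] -/
def checkCols (lo n : ℕ) : Bool := checkColsL n (wordCode.drop lo) (colCode.drop lo)

/-- Sign of a sparse entry code `e = 2t + b`: `b = 0 ↦ 1`, `b = 1 ↦ -1`. [folklore] -/
def sgE (e : ℕ) : ℤ := if e % 2 = 0 then 1 else -1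

/-- The coordinate at position `t` recorded by a sparse column `l` (sum over the entries with
`t_e = t`; no duplicate-freeness is assumed). [folklore] -/
def lookupS (l : List ℕ) (t : ℕ) : ℤ := (l.map fun e => if e / 2 = t then sgE e else 0).sum

/-- Consistency of one sparse column `l` with its packed code `c`: entries in range and agreement at
every position `t < 206`. [folklore] -/
def sparseOne (c : ℕ) (l : List ℕ) : Bool :=
  (l.all fun e => decide (e / 2 < 206)) &&
    (List.range 206).all fun t => decide (cdig c t = lookupS l t)

/-- Consistency of the sparse table with the packed columns, in lockstep. [folklore] -/
def checkSparseL : List ℕ → List (List ℕ) → Bool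
  | c :: cs, l :: ls => sparseOne c l && checkSparseL cs ls
  | _, _ => true

/-- `colSparse` is the sparse form of `colCode`. [folklore] -/
def checkSparse : Bool := checkSparseL colCode colSparse

/-- Sparse weighted Gram sum `Σ_{e ∈ l} n_{t_e} · s_e · digit_{t_e}(c')` of a sparse column `l` against
a packed column `c'`. [folklore] -/
def gramS (c' : ℕ) : List ℕ → ℤ
  | [] => 0
  | e :: es => (wt (e / 2) : ℤ) * sgE e * cdig c' (e / 2) + gramS c' es

/-- One row of the Gram identity: the word / sparse column `(w, l)` against every listed word / packed
column `(w', c')`. [folklore] -/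
def rowS (w : ℕ) (l : List ℕ) : List ℕ → List ℕ → Bool
  | w' :: ws, c' :: cs => decide (gramS c' l = targetD w w') && rowS w l ws cs
  | _, _ => true

/-- `n` consecutive rows of the Gram identity (each row against itself and all later columns).
[folklore] -/
def checkGramS : ℕ → List ℕ → List (List ℕ) → List ℕ → Bool
  | n + 1, w :: ws, l :: ls, c :: cs => rowS w l (w :: ws) (c :: cs) && checkGramS n ws ls cs
  | _, _, _, _ => true

/-- The Gram identity `Σ_t n_t p_t(I) p_t(J) = 24 (8 θ₄(1) + Re w(1))(I, J)` on the increasing word pairs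
`I ≤ J` (ranks `i ≤ j < 70`) with `lo ≤ i < lo + n`. [folklore] -/
def checkGram (lo n : ℕ) : Bool :=
  checkGramS n (wordCode.drop lo) (colSparse.drop lo) (colCode.drop lo)


end Kappa

end Summit.HodgeConjecture.HodgeConjecture.Theorems.TropicalWeilVanishing
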